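import Mathlib
import Summits.Ventures.PercRepro.TriangleCapBelowCapGen

/-!
# PercRepro — THE STABILITY TABLE BELOW THE DIAGONAL, THE WITHIN-ROW PIECES: a vertex `z` deleted onto the cell
`(k − 1, a, r')` with `D − z` `a`-bipartite — the neighbours of `z` lie on one side when `r' + 3 ≤ d(z)`, the
large side makes `D` `(a + 1)`-bipartite, and the corner `k = 2a + 2` at `r = 2` (p3, gen 44; part 196b)

* `nbhd_one_side_of_bipSub`: `D − z ⊆ K(A', A'ᶜ)` with `r'` missing cross pairs and `d(z) ≥ r' + 3` ⇒ the
  neighbours of `z` all lie in `A'` or all lie off `A'`. Otherwise, with `S` the neighbours in `A'` and `L` those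
  off `A'`, `K₄⁻`-freeness makes the edges between `S` and `L` a matching (a vertex of `S` with two neighbours in `L`
  gives two triangles on an edge at `z`), so `|S||L| − min(|S|, |L|)` cross pairs are missing — at least `d − 2`
  of the `r'`, impossible.
* `bipSub_insert_of_nbhd_off`: the neighbours of `z` off `A'` ⇒ `D ⊆ K(A' ∪ {z}, …)`, `|A' ∪ {z}| = a + 1`.
* `sum_deg_sq_le_of_bipSub`: `D ⊆ K(A, Aᶜ)` with `r` missing pairs ⇒ the closed form (the identity of the
  bipartite sub-problem with the pair count of the missing graph); `below_within_arith_gap`: `D − z` on the cell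
  `(k − 1, a, r')`, `r' = r + d − a`, with the induction hypothesis there and the neighbours at `≤ k − a − 2`
  (slack `2 (r − r')(r' + c)`); `below_bip_arith`: the other bipartition's term is exactly the target.
* `below_corner_arith`: the corner `k = 2a + 2`, `r = 2`, a vertex of degree `a` deleted onto the diagonal of
  the row `a − 1` at `2a + 1` vertices (exact).
Axioms: standard.
-/

namespace PercRepro

namespace TriangleCap

namespace C047

open Finset

variable {V : Type*} [Fintype V] [DecidableEq V]

omit [DecidableEq V] in
/-- `degIn S x ≤ deg x`. -/
theorem degIn_le_deg' (D : SimpleGraph V) [DecidableRel D.Adj] (S : Finset V) (x : V) :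
    degIn D S x ≤ deg D x := by
  unfold degIn deg
  apply card_le_card
  intro y hy
  rw [mem_filter] at hy ⊢
  exact ⟨mem_univ _, hy.2⟩

omit [Fintype V] in
/-- For `p ∈ A`, `q ∉ A`: either `p ∼ q` in `D` or `p ∼ q` in the missing graph, so
`|L| ≤ degIn L p + degIn_missing L p` for `L ⊆ Aᶜ`. -/
theorem card_le_degIn_add_degIn_missing (D : SimpleGraph V) [DecidableRel D.Adj] (A : Finset V) (L : Finset V)
    (hL : ∀ q ∈ L, q ∉ A) (p : V) (hp : p ∈ A) :
    L.card ≤ degIn D L p + degIn (missingGraph D A) L p := by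
  unfold degIn
  rw [← card_union_of_disjoint]
  · apply card_le_card
    intro q hq
    rw [mem_union, mem_filter, mem_filter, missingGraph_adj]
    by_cases h : D.Adj p q
    · exact Or.inl ⟨hq, h⟩
    · exact Or.inr ⟨hq, ⟨by tauto, h⟩⟩
  · rw [disjoint_left]
    intro q hq1 hq2
    rw [mem_filter] at hq1 hq2
    exact hq2.2.2 hq1.2

/-- The arithmetic of the mixed case: `s ℓ ≤ s + r'`, `s ℓ ≤ ℓ + r'`, `s, ℓ ≥ 1`, `r' + 3 ≤ s + ℓ` is impossible. -/
theorem mixed_arith (s l r' : ℕ) (h1 : s * l ≤ s + r') (h2 : s * l ≤ l + r') (hs : 1 ≤ s) (hl : 1 ≤ l)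
    (hd : r' + 3 ≤ s + l) : False := by
  obtain ⟨s', rfl⟩ : ∃ s', s = s' + 1 := ⟨s - 1, by omega⟩
  obtain ⟨l', rfl⟩ : ∃ l', l = l' + 1 := ⟨l - 1, by omega⟩
  rcases Nat.eq_zero_or_pos l' with hl0 | hl1
  · subst hl0
    nlinarith [h2]
  · obtain ⟨l'', rfl⟩ : ∃ l'', l' = l'' + 1 := ⟨l' - 1, by omega⟩
    nlinarith [h1, Nat.zero_le (s' * l'')]

/-- **THE NEIGHBOURS OF `z` LIE ON ONE SIDE:** `D` `K₄⁻`-free, `D − z ⊆ K(A', A'ᶜ)` with `|A'| = a` and `r'`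
missing cross pairs (`#E(D − z) + r' = a (k − 1 − a)`), `r' + 3 ≤ d(z)` ⇒ every neighbour of `z` is in `A'`, or
every neighbour of `z` is off `A'`. -/
theorem nbhd_one_side_of_bipSub (D : SimpleGraph V) [DecidableRel D.Adj] (hK : K4mFree D) (z : V)
    (A' : Finset {v : V // v ≠ z}) (a r' : ℕ) (hA' : A'.card = a) (hsub : BipSub (del D z) A')
    (hm' : (del D z).edgeFinset.card + r' = a * (Fintype.card {v : V // v ≠ z} - a))
    (hd : r' + 3 ≤ deg D z) :
    (∀ w : {v : V // v ≠ z}, D.Adj w.1 z → w ∈ A') ∨ (∀ w : {v : V // v ≠ z}, D.Adj w.1 z → w ∉ A') := by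
  by_contra hcon
  push Not at hcon
  obtain ⟨⟨w₁, hw₁z, hw₁A⟩, ⟨w₂, hw₂z, hw₂A⟩⟩ := hcon
  -- the neighbours in `A'` and off `A'`
  obtain ⟨S, hS⟩ : ∃ S : Finset {v : V // v ≠ z}, S = univ.filter (fun w => D.Adj w.1 z ∧ w ∈ A') := ⟨_, rfl⟩
  obtain ⟨L, hL⟩ : ∃ L : Finset {v : V // v ≠ z}, L = univ.filter (fun w => D.Adj w.1 z ∧ w ∉ A') := ⟨_, rfl⟩
  have hmemS : ∀ w, w ∈ S ↔ D.Adj w.1 z ∧ w ∈ A' := fun w => by rw [hS, mem_filter]; simp only [mem_univ, true_and]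
  have hmemL : ∀ w, w ∈ L ↔ D.Adj w.1 z ∧ w ∉ A' := fun w => by rw [hL, mem_filter]; simp only [mem_univ, true_and]
  have hSL : S.card + L.card = deg D z := by
    have h := sum_del_nbhd_const D z 1
    rw [mul_one] at h
    rw [← h, hS, hL, card_filter, card_filter, ← sum_add_distrib]
    apply sum_congr rfl
    intro w _
    by_cases h1 : D.Adj w.1 z <;> by_cases h2 : w ∈ A' <;> simp [h1, h2]
  have hSpos : 1 ≤ S.card := card_pos.mpr ⟨w₂, (hmemS w₂).mpr ⟨hw₂z, hw₂A⟩⟩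
  have hLpos : 1 ≤ L.card := card_pos.mpr ⟨w₁, (hmemL w₁).mpr ⟨hw₁z, hw₁A⟩⟩
  have hdisj : Disjoint S L := by
    rw [disjoint_left]
    intro w hw1 hw2
    exact ((hmemL w).mp hw2).2 ((hmemS w).mp hw1).2
  -- a vertex of `S` has at most one neighbour in `L` (two would give two triangles on an edge at `z`)
  have hSone : ∀ p ∈ S, degIn (del D z) L p ≤ 1 := by
    intro p hp
    by_contra hcon
    push Not at hcon
    unfold degIn at hcon
    obtain ⟨q, hq, q', hq', hqq'⟩ := one_lt_card.mp hcon
    rw [mem_filter] at hq hq'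
    have hpz := ((hmemS p).mp hp).1
    have hqz := ((hmemL q).mp hq.1).1
    have hq'z := ((hmemL q').mp hq'.1).1
    exact not_adj_both D hK (D.adj_symm hpz) (D.adj_symm hqz) ((del_adj D z p q).mp hq.2)
      (fun h => hqq' (Subtype.ext h)) (D.adj_symm hq'z) ((del_adj D z p q').mp hq'.2)
  have hLone : ∀ q ∈ L, degIn (del D z) S q ≤ 1 := by
    intro q hq
    by_contra hcon
    push Not at hcon
    unfold degIn at hcon
    obtain ⟨p, hp, p', hp', hpp'⟩ := one_lt_card.mp hcon
    rw [mem_filter] at hp hp'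
    have hqz := ((hmemL q).mp hq).1
    have hpz := ((hmemS p).mp hp.1).1
    have hp'z := ((hmemS p').mp hp'.1).1
    exact not_adj_both D hK (D.adj_symm hqz) (D.adj_symm hpz) ((del_adj D z q p).mp hp.2)
      (fun h => hpp' (Subtype.ext h)) (D.adj_symm hp'z) ((del_adj D z q p').mp hp'.2)
  -- `e = ` the edges between `S` and `L`: `e ≤ |S|`, `e ≤ |L|`
  obtain ⟨e, he⟩ : ∃ e, ∑ p ∈ S, degIn (del D z) L p = e := ⟨_, rfl⟩
  have heS : e ≤ S.card := by
    rw [← he]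
    calc ∑ p ∈ S, degIn (del D z) L p ≤ ∑ _p ∈ S, 1 := sum_le_sum hSone
      _ = S.card := by rw [sum_const, smul_eq_mul, mul_one]
  have heL : e ≤ L.card := by
    rw [← he, sum_degIn_comm]
    calc ∑ q ∈ L, degIn (del D z) S q ≤ ∑ _q ∈ L, 1 := sum_le_sum hLone
      _ = L.card := by rw [sum_const, smul_eq_mul, mul_one]
  -- the missing pairs between `S` and `L`, counted from both sides, are at most `r'` in all
  have hMcard := card_edges_missingGraph (del D z) A' hsub a r' hA' hm'
  have hMsum := sum_deg_eq (missingGraph (del D z) A')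
  rw [hMcard] at hMsum
  have hSmiss : S.card * L.card ≤ e + ∑ p ∈ S, deg (missingGraph (del D z) A') p := by
    rw [← he, ← sum_add_distrib]
    calc S.card * L.card = ∑ _p ∈ S, L.card := by rw [sum_const, smul_eq_mul]
      _ ≤ ∑ p ∈ S, (degIn (del D z) L p + deg (missingGraph (del D z) A') p) := by
        apply sum_le_sum
        intro p hp
        have h1 := card_le_degIn_add_degIn_missing (del D z) A' L (fun q hq => ((hmemL q).mp hq).2) p
          ((hmemS p).mp hp).2
        have h2 := degIn_le_deg' (missingGraph (del D z) A') L p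
        omega
  have hLmiss : S.card * L.card ≤ e + ∑ q ∈ L, deg (missingGraph (del D z) A') q := by
    rw [← he, sum_degIn_comm, ← sum_add_distrib]
    calc S.card * L.card = ∑ _q ∈ L, S.card := by rw [sum_const, smul_eq_mul, mul_comm]
      _ ≤ ∑ q ∈ L, (degIn (del D z) S q + deg (missingGraph (del D z) A') q) := by
        apply sum_le_sum
        intro q hq
        have h1 := card_le_degIn_add_degIn_missing (del D z) A'ᶜ S
          (fun p hp => by rw [mem_compl, not_not]; exact ((hmemS p).mp hp).2) q
          (by rw [mem_compl]; exact ((hmemL q).mp hq).2)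
        have h2 := degIn_le_deg' (missingGraph (del D z) A') S q
        have h3 : degIn (missingGraph (del D z) A'ᶜ) S q = degIn (missingGraph (del D z) A') S q := by
          unfold degIn
          congr 1
          apply filter_congr
          intro p _
          rw [missingGraph_adj, missingGraph_adj, mem_compl, mem_compl]
          tauto
        omega
  have htot : ∑ p ∈ S, deg (missingGraph (del D z) A') p + ∑ q ∈ L, deg (missingGraph (del D z) A') q ≤
      2 * r' := by
    rw [← sum_union hdisj, ← hMsum]
    exact sum_le_sum_of_subset (subset_univ _)
  exact mixed_arith S.card L.card r' (by omega) (by omega) hSpos hLpos (by omega)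

omit [Fintype V] in
/-- **THE LIFT TO THE OTHER BIPARTITION:** `D − z ⊆ K(A', A'ᶜ)` and every neighbour of `z` off `A'` ⇒
`D ⊆ K(A, Aᶜ)` for `A = A' ∪ {z}`, `|A| = |A'| + 1`. -/
theorem bipSub_insert_of_nbhd_off (D : SimpleGraph V) (z : V) (A' : Finset {v : V // v ≠ z})
    (hsub : BipSub (del D z) A') (hnb : ∀ w : {v : V // v ≠ z}, D.Adj w.1 z → w ∉ A') :
    ∃ A : Finset V, A.card = A'.card + 1 ∧ BipSub D A := by
  have hz : z ∉ A'.map (Function.Embedding.subtype _) := by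
    rw [mem_map]
    rintro ⟨x, _, hx⟩
    exact x.2 hx
  refine ⟨insert z (A'.map (Function.Embedding.subtype _)), by rw [card_insert_of_notMem hz, card_map], ?_⟩
  have hmem : ∀ x : {v : V // v ≠ z}, x.1 ∈ A'.map (Function.Embedding.subtype _) ↔ x ∈ A' := fun x =>
    mem_map' _
  intro x y hxy
  by_cases hxz : x = z
  · subst hxz
    have hyz : y ≠ x := fun h => D.irrefl (h ▸ hxy)
    have hy := hnb ⟨y, hyz⟩ (D.adj_symm hxy)
    rw [mem_insert, mem_insert, hmem ⟨y, hyz⟩]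
    tauto
  by_cases hyz : y = z
  · subst hyz
    have hx := hnb ⟨x, hxz⟩ hxy
    rw [mem_insert, mem_insert, hmem ⟨x, hxz⟩]
    tauto
  have h := hsub ⟨x, hxz⟩ ⟨y, hyz⟩ ((del_adj D z _ _).mpr hxy)
  rw [mem_insert, mem_insert, hmem ⟨x, hxz⟩, hmem ⟨y, hyz⟩]
  tauto

/-- **THE BIPARTITE BOUND:** a spanning subgraph of `K(A, Aᶜ)`, `|A| = a`, with `r` missing cross pairs
(`r + 1 ≤ k`) has `Σ_v d(v)² + r (k − 1 − r) ≤ m k` — the identity of the bipartite sub-problem with the pair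
count `Σ_v h(v)² ≤ r (r + 1)` of the missing graph. -/
theorem sum_deg_sq_le_of_bipSub (D : SimpleGraph V) [DecidableRel D.Adj] (A : Finset V) (hD : BipSub D A)
    (a r : ℕ) (hA : A.card = a) (hm : D.edgeFinset.card + r = a * (Fintype.card V - a))
    (hr : r + 1 ≤ Fintype.card V) :
    ∑ v, deg D v * deg D v + r * (Fintype.card V - 1 - r) ≤ D.edgeFinset.card * Fintype.card V := by
  have key := sum_deg_sq_bipSub D A hD
  have hM := card_edges_missingGraph D A hD a r hA hm
  have hpair := sum_deg_mul_deg_le_card_edges (missingGraph D A)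
  rw [hM, hA] at key
  rw [hM] at hpair
  obtain ⟨k, hk⟩ : ∃ k, Fintype.card V = k := ⟨_, rfl⟩
  obtain ⟨S, hS⟩ : ∃ S, ∑ v, deg D v * deg D v = S := ⟨_, rfl⟩
  obtain ⟨H, hH⟩ : ∃ H, ∑ v, deg (missingGraph D A) v * deg (missingGraph D A) v = H := ⟨_, rfl⟩
  obtain ⟨m, hmdef⟩ : ∃ m, D.edgeFinset.card = m := ⟨_, rfl⟩
  rw [hk] at key hm hr
  rw [hS, hH] at key
  rw [hH] at hpair
  rw [hmdef] at hm
  rw [hS, hk, hmdef]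
  obtain ⟨u, rfl⟩ : ∃ u, k = r + 1 + u := ⟨k - (r + 1), by omega⟩
  have e : r + 1 + u - 1 - r = u := by omega
  rw [e]
  nlinarith [key, hpair, hm]

/-- The within-row arithmetic at a general distance: `r = t + s`, `a = t + s + q`, the vertex `z` of degree
`d = q + t` deleted onto the cell `(k − 1, a, t)`, `k = 2a + 2 + c`; the induction hypothesis there and the
neighbours of `z` at `≤ k − a − 2`: the slack is `2 s (t + c)`. -/
theorem below_within_arith_gap (t s q c m' S' T : ℕ)
    (hm' : m' + (q + t) + (t + s) = (t + s + q) * (t + s + q + 2 + c))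
    (hS' : S' + t * (t + 2 * s + 2 * q + c) + 2 * c * (s + q) ≤ m' * (2 * (t + s + q) + 1 + c))
    (hT : T ≤ (q + t) * (t + s + q + c)) :
    S' + 2 * T + (q + t) + (q + t) * (q + t) + (t + s) * (t + s + 2 * q + 1 + c) + 2 * (c + 1) * q ≤
      (m' + (q + t)) * (2 * (t + s + q) + 2 + c) := by
  nlinarith [hS', hT, Nat.zero_le (s * (t + c))]

/-- The bipartite identity of the within-row case: on the cell `(k, a, r)` with `a = r + q`, `k = 2a + 2 + c`,
the other bipartition's term `r'' (k − 1 − r'')` at `r'' = k − 2a − 1 + r` equals `r (k − 1 − r) + 2 (k − 2a − 1)(a − r)`. -/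
theorem below_bip_arith (r q c : ℕ) :
    (c + 1 + r) * (r + 2 * q) = r * (r + 2 * q + 1 + c) + 2 * (c + 1) * q := by
  ring

/-- The corner arithmetic: `r = 2`, `k = 2a + 2` (`a = a5 + 5`), a vertex of degree `a` deleted onto the diagonal
of the row `a − 1` at `2a + 1` vertices (the gap `2 (a − 1) · 2` there, the neighbours at `≤ a`): exact. -/
theorem below_corner_arith (a5 m' S' T : ℕ) (hm' : m' + (a5 + 5) + 2 = (a5 + 5) * (a5 + 5 + 2))
    (hS' : S' + 2 * (a5 + 4) * 2 ≤ m' * (2 * (a5 + 5) + 1)) (hT : T ≤ (a5 + 5) * (a5 + 5)) :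
    S' + 2 * T + (a5 + 5) + (a5 + 5) * (a5 + 5) + 2 * (2 * (a5 + 5) + 2 - 1 - 2) +
      2 * (2 * (a5 + 5) + 2 - 2 * (a5 + 5) - 1) * (a5 + 5 - 2) ≤ (m' + (a5 + 5)) * (2 * (a5 + 5) + 2) := by
  have e1 : 2 * (a5 + 5) + 2 - 1 - 2 = 2 * a5 + 9 := by omega
  have e2 : 2 * (a5 + 5) + 2 - 2 * (a5 + 5) - 1 = 1 := by omega
  have e3 : a5 + 5 - 2 = a5 + 3 := by omega
  rw [e1, e2, e3]
  nlinarith [hS', hT, hm']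

end C047

end TriangleCap

end PercRepro
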